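import Summits.HodgeConjecture.HodgeConjecture.Theorems.F0P3IrreducibleConstituentOfUnitary   -- this seat: `exists_irreducible_subrepresentation_of_isSmoothVector`
import Summits.HodgeConjecture.HodgeConjecture.Theorems.F0P3RamClsOfRecordAntihol          -- this seat ★ p822332: conj transport `conjEquiv_symm_ne_zero` …, (A4c) `…_of_conj`
import Summits.HodgeConjecture.HodgeConjecture.Theorems.F0P3LocalIsotypyFinOfRecord         -- ★ p02 (g7): `eq_clFinChoice_of_isConstituentOf`
import Literature.NumberTheory.Automorphic.UnitaryGroupAutomorphicFlathAdmissible         -- ★ p822536 «AFA» `AutomorphicFlathAdmissible` (the letter's text)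
import HarnessLib

/-!
# Crux `H413` — rung 4, row #22 (L7″) pay-down: «AFA» (an irreducible ADMISSIBLE finite component) holds ON THE COTANGENT LOCUS, in-house —
# and the law `LocalIsotypyFin` at `𝔠₀` for `P` of cotangent type (Bernstein–Zelevinsky §2.3; Borel–Jacquet §4.3, §4.6; Borel–Wallach VII 2.10, XIII 1.2)

Floor-0 programme P3 «U3-mult», seat B-p08 (g20); crux item stmt-HodgeConjecture-24833 (`HCCMUnconditional.H413`); B-p08 OFFER 12:14Z on PLAN.F0P3g5 row #22:
the T5 v6 law `localIsotypyFin` is consumed only at the head's `P` (`memb P ξ hfin` under `hP : IsCot P`), and its 𝔠₀ discharger ★ `localIsotypyFin₀_of_hAF` uses the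
letter «AFA» ★ `AutomorphicFlathAdmissible` [FlathCorvallis1979 Thm. 3] only AT THAT `P`.  THIS FILE proves the «AFA» text AT EVERY `P` OF COTANGENT TYPE with no
letter: `exists_irreducible_admissible_hasFinComponent_of_isCot`, and hence the guarded law `localIsotypyFin₀_of_isCot`.  PROOF lane
(`--supports stmt-HodgeConjecture-24833 --as helper`): theorems only — no `def`, no named fact, no instance, no notation, no `sorry`.
HONEST LABEL: HC_CM is proved only modulo the printed citations until rung 0 closes; this file discharges none of them (it makes «AFA» unnecessary on the
cotangent locus; whether row #22 leaves the closer's hypotheses is the dossier's decision — guard the law by `IsCot P`).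

THE ARGUMENT (GLOBAL twin of «RC»).  For `v₀ ∈ P`, `v₀ ≠ 0`, smooth for `U(H)(𝔸_{L⁺,f})`, with `cl span{P(b) v₀} ⊓ P^{K′}` finite-dimensional for every compact
open `K′` (holomorphic: ★ (A4c) `finiteDimensional_closureSpan_inf_fixedPoints` at a coordinate class of the hol form — Matsushima finiteness on the compact quotient;
antiholomorphic: the same in `P̄` pulled back along `e = conjEquiv`, ★ `finiteDimensional_closureSpan_inf_fixedPoints_of_conj`), the span `S := ℂ[U(H)(𝔸_f)]·v₀`
is stable, made of smooth vectors, with `S ⊓ P^{K′}` finite-dimensional; the generic ★ `exists_irreducible_subrepresentation_of_isSmoothVector` (minimal block of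
`K`-fixed vectors, `K := Stab(v₀) ⊓ K_f⁰`; complements from the invariant inner product of `P`, (U♮)) yields an IRREDUCIBLE ADMISSIBLE sub-representation `N₁ ≤ S`
of `P.finRep`; its inclusion is an injective intertwiner, i.e. `P.HasFinComponent N₁`.

* §1 `exists_irreducible_admissible_hasFinComponent_of_finite` (abstract finiteness input, as ★ `F0P3RamClsOfRecordAntihol` §2);
* §2 `…_of_isHolCotangentAt`, `…_of_isAntiholCotangentAt`, **`exists_irreducible_admissible_hasFinComponent_of_isCot`** (the «AFA» text at cotangent `P`);
* §3 **`localIsotypyFin₀_of_isCot`** — the T5 law (L7″) at `𝔠₀` for cotangent `P` (★ `eq_clFinChoice_of_isConstituentOf`), and `localIsotypyFin₀_of_hAF`'s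
  hypothesis restricted to the cotangent locus `hAF_of_isCot`.

References: [BernsteinZelevinsky1976] §2.1–2.3; [Bump1997] §4.2 Prop. 4.2.3; [Casselman1995] §2.1; [BorelJacquetCorvallis1979] §4.3, §4.6; [BorelWallach2000] VII 2.10,
3.2, XIII 1.2; [FlathCorvallis1979] Thm. 3 (the statement made unnecessary here); [Rogawski1990] §14.5 p. 237.
-/

set_option autoImplicit false
set_option linter.dupNamespace false

noncomputable section

open scoped InnerProductSpace Matrix ComplexOrder
open MeasureTheory NumberField IsDedekindDomain Filter MulAction
open Literature.NumberTheory.Automorphic Literature.NumberTheory.Automorphic.UnitaryGroup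
open Literature.NumberTheory.Automorphic.UnitaryGroup.CotangentForms
open Summit.HodgeConjecture.HodgeConjecture.Cruxes.H413.F0P3ClassTokenChoice
open Summit.HodgeConjecture.HodgeConjecture.Cruxes.H413.F0P3CotangentFormValueMap (exists_vectors)
open Summit.HodgeConjecture.HodgeConjecture.Cruxes.H413.F0P3StubF1bCM (coe_coord_ne_zero)
open Summit.HodgeConjecture.HodgeConjecture.Cruxes.H413.F0P3CotangentFormL2Span (memLp_toQuotFun_apply)
open Summit.HodgeConjecture.HodgeConjecture.Cruxes.H413.F0P3HolProjectionReduction (compactSpace_automorphicQuotient_cm)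
open Summit.HodgeConjecture.HodgeConjecture.Cruxes.H413.F0P3ProjectionPreservesType (isOpen_stabilizer rightRegular_toLp_of_mem_stabilizer)
open Summit.HodgeConjecture.HodgeConjecture.Cruxes.H413.F0P3TranslateDetection (isUnitary_toContRep)
open Summit.HodgeConjecture.HodgeConjecture.Cruxes.H413.F0P3SphericalConstituentOfUnitary (span_translates_stable)
open Summit.HodgeConjecture.HodgeConjecture.Cruxes.H413.F0P3IrreducibleConstituentOfUnitary
open Summit.HodgeConjecture.HodgeConjecture.Cruxes.H413.F0P3RamClsOfRecordAntihol
open Summit.HodgeConjecture.HodgeConjecture.Cruxes.H413.F0P3ClassTokensOfRecord (cl rep)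
open Summit.HodgeConjecture.HodgeConjecture.Cruxes.H413.F0P3LocalIsotypyFinOfRecord (eq_clFinChoice_of_isConstituentOf)

namespace Summit.HodgeConjecture.HodgeConjecture.Cruxes.H413.F0P3AutomorphicFlathAdmissibleOfCot

variable {L : Type} [Field L] [NumberField L] [IsCMField L] {H : Matrix (Fin 3) (Fin 3) L}

/-! ## §1 An irreducible admissible finite component from a smooth vector with admissible closed span -/

section Abstract

variable {μ : Measure (adelicGroupData (↥(maximalRealSubfield L)) L (IsCMField.complexConj L) 3 H).automorphicQuotient}
  [(adelicGroupData (↥(maximalRealSubfield L)) L (IsCMField.complexConj L) 3 H).IsAutomorphicMeasure μ]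
  (P : DiscreteAutomorphicRep (adelicGroupData (↥(maximalRealSubfield L)) L (IsCMField.complexConj L) 3 H) μ)

/-- **«AFA» AT `P` FROM ONE GOOD VECTOR.**  `v₀ ∈ P`, `v₀ ≠ 0`, smooth, with `cl span{P(b) v₀} ⊓ P^{K″}` finite-dimensional for all compact open `K″` ⟹ `P` has an
IRREDUCIBLE ADMISSIBLE finite component (★ `HasFinComponent`): the generic ★ `exists_irreducible_subrepresentation_of_isSmoothVector` in the unitary `P.finRep` on
`S := ℂ[U(H)(𝔸_f)]·v₀` with `K := Stab(v₀) ⊓ K_f⁰`, and the inclusion `N₁ ↪ P`. [cite: BernsteinZelevinsky1976, §2.3] [cite: BorelJacquetCorvallis1979, §4.3 and §4.6]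
[cite: Bump1997, §4.2 Prop. 4.2.3] -/
theorem exists_irreducible_admissible_hasFinComponent_of_finite (v₀ : P.space.toSubmodule)
    (hfin : ∀ K'' : Subgroup (finAdelic (↥(maximalRealSubfield L)) L (IsCMField.complexConj L) 3 H),
      IsOpen (K'' : Set (finAdelic (↥(maximalRealSubfield L)) L (IsCMField.complexConj L) 3 H)) →
      IsCompact (K'' : Set (finAdelic (↥(maximalRealSubfield L)) L (IsCMField.complexConj L) 3 H)) →
        FiniteDimensional ℂ ↥((Submodule.span ℂ (Set.range fun b => P.finRep b v₀)).topologicalClosure ⊓ P.finRep.fixedPoints K''))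
    (hv₀0 : v₀ ≠ 0) (hv₀s : P.finRep.IsSmoothVector v₀) :
    ∃ (W : Type) (_ : AddCommGroup W) (_ : Module ℂ W)
      (σ : Representation ℂ (finAdelic (↥(maximalRealSubfield L)) L (IsCMField.complexConj L) 3 H) W),
      σ.IsIrreducible ∧ σ.IsAdmissible ∧ P.HasFinComponent σ := by
  have hU : ∀ (g : finAdelic (↥(maximalRealSubfield L)) L (IsCMField.complexConj L) 3 H) (x y : ↥P.space.toSubmodule),
      ⟪P.finRep g x, P.finRep g y⟫_ℂ = ⟪x, y⟫_ℂ := fun g x y => (isUnitary_toContRep P).inner_map_map _ _ _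
  -- the span `S` of the translates of `v₀`: stable, smooth, `S ⊓ P^{K′}` finite-dimensional
  let S : Submodule ℂ ↥P.space.toSubmodule := Submodule.span ℂ (Set.range fun b => P.finRep b v₀)
  have hS : ∀ (g : finAdelic (↥(maximalRealSubfield L)) L (IsCMField.complexConj L) 3 H) (x : ↥P.space.toSubmodule), x ∈ S → P.finRep g x ∈ S :=
    fun g x hx => span_translates_stable (ρ := P.finRep) v₀ g hx
  have hSsm : ∀ x ∈ S, P.finRep.IsSmoothVector x := by
    intro x hx
    induction hx using Submodule.span_induction with
    | mem x hx =>
      obtain ⟨h, rfl⟩ := hx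
      exact Representation.IsSmoothVector.apply P.finRep _ hv₀s
    | zero => exact P.finRep.isSmoothVector_zero
    | add x y _ _ hx hy => exact Representation.IsSmoothVector.add P.finRep hx hy
    | smul c x _ hx => exact Representation.IsSmoothVector.smul P.finRep c hx
  have hSfin : ∀ K' : Subgroup (finAdelic (↥(maximalRealSubfield L)) L (IsCMField.complexConj L) 3 H),
      IsOpen (K' : Set (finAdelic (↥(maximalRealSubfield L)) L (IsCMField.complexConj L) 3 H)) →
      IsCompact (K' : Set (finAdelic (↥(maximalRealSubfield L)) L (IsCMField.complexConj L) 3 H)) →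
        FiniteDimensional ℂ ↥(S ⊓ P.finRep.fixedPoints K') := fun K' hK'o hK'c => by
    haveI := hfin K' hK'o hK'c
    exact Submodule.finiteDimensional_of_le (inf_le_inf_right _ (Submodule.le_topologicalClosure S))
  -- the compact open level `K = Stab(v₀) ⊓ K_f⁰`
  set K : Subgroup (finAdelic (↥(maximalRealSubfield L)) L (IsCMField.complexConj L) 3 H) :=
    P.finRep.stabilizerSubgroup v₀ ⊓ finAdelicIntegralLevel (↥(maximalRealSubfield L)) L (IsCMField.complexConj L) 3 H with hKdef
  have hKo : IsOpen (K : Set (finAdelic (↥(maximalRealSubfield L)) L (IsCMField.complexConj L) 3 H)) := by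
    rw [hKdef, Subgroup.coe_inf]
    exact hv₀s.inter (isOpen_finAdelicIntegralLevel (↥(maximalRealSubfield L)) L (IsCMField.complexConj L) 3 H)
  have hKc : IsCompact (K : Set (finAdelic (↥(maximalRealSubfield L)) L (IsCMField.complexConj L) 3 H)) :=
    (isCompact_finAdelicIntegralLevel (↥(maximalRealSubfield L)) L (IsCMField.complexConj L) 3 H).of_isClosed_subset
      (Subgroup.isClosed_of_isOpen _ hKo) (by rw [hKdef, Subgroup.coe_inf]; exact Set.inter_subset_right)
  have hx₀K : v₀ ∈ P.finRep.fixedPoints K :=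
    by
    have hKstab : K ≤ P.finRep.stabilizerSubgroup v₀ := inf_le_left
    exact (Representation.mem_fixedPoints _ _ _).2 fun u hu => (P.finRep.mem_stabilizerSubgroup v₀ _).1 (hKstab hu)
  have hx₀S : v₀ ∈ S := Submodule.subset_span ⟨1, by simp only [map_one, Module.End.one_apply]⟩
  obtain ⟨N₁, -, hirr, -, hadm, -, -⟩ :=
    exists_irreducible_subrepresentation_of_isSmoothVector (ρ := P.finRep) hU hKo hKc S hS hSsm hSfin hv₀0 hx₀K hx₀S
  -- the inclusion `N₁ ↪ P` is an injective intertwiner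
  let f : N₁.toRepresentation.IntertwiningMap P.finRep :=
    LinearMap.intertwiningMap_of_isIntertwiningMap (ρ := N₁.toRepresentation) (σ := P.finRep) N₁.toSubmodule.subtype fun _ _ => rfl
  have hf : Function.Injective f := by
    intro a b h
    have h' : N₁.toSubmodule.subtype a = N₁.toSubmodule.subtype b := h
    exact Subtype.ext h'
  exact ⟨↥N₁.toSubmodule, inferInstance, inferInstance, N₁.toRepresentation, hirr, hadm, ⟨f, hf⟩⟩

end Abstract

/-! ## §2 The cotangent locus: holomorphic, antiholomorphic, `IsCot` -/

section Cot

variable (ι : L →+* ℂ) (T : GL (Fin 3) ℂ)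
  (hT : (T : Matrix (Fin 3) (Fin 3) ℂ)ᴴ * H.map ι * (T : Matrix (Fin 3) (Fin 3) ℂ) = Literature.Geometry.ComplexHyperbolic.BallModel.J)
  {μ : Measure (adelicGroupData (↥(maximalRealSubfield L)) L (IsCMField.complexConj L) 3 H).automorphicQuotient}
  [(adelicGroupData (↥(maximalRealSubfield L)) L (IsCMField.complexConj L) 3 H).IsAutomorphicMeasure μ]

/-- **«AFA» at a HOLOMORPHIC-cotangent `P`, in-house**: the coordinate class `v₀` of the hol form (★ B1′ `exists_vectors`, ★ `coe_coord_ne_zero`, smooth by ★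
`isOpen_stabilizer`) with ★ (A4c) `finiteDimensional_closureSpan_inf_fixedPoints`, then §1. [cite: BorelWallach2000, VII 3.2 and XIII 1.2]
[cite: BorelJacquetCorvallis1979, §4.3 and §4.6] [cite: BernsteinZelevinsky1976, §2.3] -/
theorem exists_irreducible_admissible_hasFinComponent_of_isHolCotangentAt
    (hdef : ∀ τ' : L →+* ℂ, InfinitePlace.mk τ' ≠ InfinitePlace.mk ι → (H.map τ').PosDef) (h2 : 2 ≤ Module.finrank ℚ ↥(maximalRealSubfield L))
    (P : DiscreteAutomorphicRep (adelicGroupData (↥(maximalRealSubfield L)) L (IsCMField.complexConj L) 3 H) μ)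
    (hP : P.IsHolCotangentAt (cmArchSection L ι H T hT) (cmCompactFactor L ι H T hT)) :
    ∃ (W : Type) (_ : AddCommGroup W) (_ : Module ℂ W)
      (σ : Representation ℂ (finAdelic (↥(maximalRealSubfield L)) L (IsCMField.complexConj L) 3 H) W),
      σ.IsIrreducible ∧ σ.IsAdmissible ∧ P.HasFinComponent σ := by
  haveI := compactSpace_automorphicQuotient_cm hdef h2 (L := L) (ι := ι) (H := H)
  obtain ⟨Φ, hΦ, hΦ0, hPΦ⟩ := hP
  have hPj : ∀ j : Fin 2, (memLp_toQuotFun_apply ι T hT (μ := μ) hΦ j).toLp _ ∈ P.space.toSubmodule :=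
    fun j => (hPΦ j).elim fun _ hh => hh
  obtain ⟨w, hwx⟩ := exists_vectors ι T hT P hΦ hPj
  have hw : ∀ j : Fin 2, ∃ hm : MemLp (toQuotFun (adelicGroupData (↥(maximalRealSubfield L)) L (IsCMField.complexConj L) 3 H) fun x => Φ x j) 2 μ,
      (((w j : P.archModuleCM ι T hT) : P.space.toSubmodule) : (adelicGroupData (↥(maximalRealSubfield L)) L (IsCMField.complexConj L) 3 H).L2 μ) =
        hm.toLp _ := fun j => ⟨_, hwx j⟩
  have hv₀0 := coe_coord_ne_zero ι T hT hdef h2 μ P hΦ hΦ0 w hw 0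
  let v₀ : P.space.toSubmodule := ((w 0 : P.archModuleCM ι T hT) : P.space.toSubmodule)
  have hv₀s : P.finRep.IsSmoothVector v₀ := by
    refine P.finRep.isSmoothVector_of_le (isOpen_stabilizer hΦ) fun g hg => ?_
    rw [Representation.mem_stabilizerSubgroup]
    apply Subtype.ext
    change (adelicGroupData (↥(maximalRealSubfield L)) L (IsCMField.complexConj L) 3 H).rightRegular μ
        (finAdelicToAdelic (↥(maximalRealSubfield L)) L (IsCMField.complexConj L) 3 H g)
        (((w 0 : P.archModuleCM ι T hT) : P.space.toSubmodule) : (adelicGroupData (↥(maximalRealSubfield L)) L (IsCMField.complexConj L) 3 H).L2 μ) = _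
    rw [hwx 0]
    exact rightRegular_toLp_of_mem_stabilizer hΦ hg (memLp_toQuotFun_apply ι T hT (μ := μ) hΦ 0)
  exact exists_irreducible_admissible_hasFinComponent_of_finite P v₀
    (fun K'' hK''o hK''c => F0P3FinComponentAdmissible.finiteDimensional_closureSpan_inf_fixedPoints ι T hT μ hdef h2 P hΦ v₀ 0 (hw 0) K'' hK''o hK''c)
    hv₀0 hv₀s

/-- **«AFA» at an ANTIHOLOMORPHIC-cotangent `P`, in-house**: the hol data in `P̄` (★ `isAntiholCotangentAt_iff_conj`) pulled back along `e⁻¹` (★ p822332 §1: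
`conjEquiv_symm_ne_zero`, `isSmoothVector_conjEquiv_symm`, `finiteDimensional_closureSpan_inf_fixedPoints_of_conj`), then §1. [cite: BorelWallach2000, VII 2.10 and 3.2]
[cite: BorelJacquetCorvallis1979, §4.3 and §4.6] [cite: BernsteinZelevinsky1976, §2.3] -/
theorem exists_irreducible_admissible_hasFinComponent_of_isAntiholCotangentAt
    (hdef : ∀ τ' : L →+* ℂ, InfinitePlace.mk τ' ≠ InfinitePlace.mk ι → (H.map τ').PosDef) (h2 : 2 ≤ Module.finrank ℚ ↥(maximalRealSubfield L))
    (P : DiscreteAutomorphicRep (adelicGroupData (↥(maximalRealSubfield L)) L (IsCMField.complexConj L) 3 H) μ)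
    (hP : P.IsAntiholCotangentAt (cmArchSection L ι H T hT) (cmCompactFactor L ι H T hT)) :
    ∃ (W : Type) (_ : AddCommGroup W) (_ : Module ℂ W)
      (σ : Representation ℂ (finAdelic (↥(maximalRealSubfield L)) L (IsCMField.complexConj L) 3 H) W),
      σ.IsIrreducible ∧ σ.IsAdmissible ∧ P.HasFinComponent σ := by
  haveI := compactSpace_automorphicQuotient_cm hdef h2 (L := L) (ι := ι) (H := H)
  obtain ⟨Φ, hΦ, hΦ0, hPΦ⟩ := (isAntiholCotangentAt_iff_conj P _ _).1 hP
  have hPj : ∀ j : Fin 2, (memLp_toQuotFun_apply ι T hT (μ := μ) hΦ j).toLp _ ∈ P.conj.space.toSubmodule :=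
    fun j => (hPΦ j).elim fun _ hh => hh
  obtain ⟨w, hwx⟩ := exists_vectors ι T hT P.conj hΦ hPj
  have hw : ∀ j : Fin 2, ∃ hm : MemLp (toQuotFun (adelicGroupData (↥(maximalRealSubfield L)) L (IsCMField.complexConj L) 3 H) fun x => Φ x j) 2 μ,
      (((w j : P.conj.archModuleCM ι T hT) : P.conj.space.toSubmodule) : (adelicGroupData (↥(maximalRealSubfield L)) L (IsCMField.complexConj L) 3 H).L2 μ) =
        hm.toLp _ := fun j => ⟨_, hwx j⟩
  have hu₀0 := coe_coord_ne_zero ι T hT hdef h2 μ P.conj hΦ hΦ0 w hw 0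
  let u₀ : P.conj.space.toSubmodule := ((w 0 : P.conj.archModuleCM ι T hT) : P.conj.space.toSubmodule)
  have hu₀s : P.conj.finRep.IsSmoothVector u₀ := by
    refine P.conj.finRep.isSmoothVector_of_le (isOpen_stabilizer hΦ) fun g hg => ?_
    rw [Representation.mem_stabilizerSubgroup]
    apply Subtype.ext
    change (adelicGroupData (↥(maximalRealSubfield L)) L (IsCMField.complexConj L) 3 H).rightRegular μ
        (finAdelicToAdelic (↥(maximalRealSubfield L)) L (IsCMField.complexConj L) 3 H g)
        (((w 0 : P.conj.archModuleCM ι T hT) : P.conj.space.toSubmodule) : (adelicGroupData (↥(maximalRealSubfield L)) L (IsCMField.complexConj L) 3 H).L2 μ) = _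
    rw [hwx 0]
    exact rightRegular_toLp_of_mem_stabilizer hΦ hg (memLp_toQuotFun_apply ι T hT (μ := μ) hΦ 0)
  exact exists_irreducible_admissible_hasFinComponent_of_finite P (P.space.conjEquiv.symm u₀)
    (fun K'' hK''o hK''c => by
      haveI := F0P3FinComponentAdmissible.finiteDimensional_closureSpan_inf_fixedPoints ι T hT μ hdef h2 P.conj hΦ u₀ 0 (hw 0) K'' hK''o hK''c
      exact finiteDimensional_closureSpan_inf_fixedPoints_of_conj P u₀ K'')
    (conjEquiv_symm_ne_zero P hu₀0) (isSmoothVector_conjEquiv_symm P hu₀s)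

/-- **«AFA» ON THE COTANGENT LOCUS (`IsCot P` = hol ∨ antihol at the CM frame), in-house** — the text of ★ `AutomorphicFlathAdmissible` [FlathCorvallis1979 Thm. 3] AT `P`,
with no letter. [cite: BernsteinZelevinsky1976, §2.3] [cite: BorelJacquetCorvallis1979, §4.3 and §4.6] [cite: BorelWallach2000, VII 2.10, 3.2 and XIII 1.2] -/
theorem exists_irreducible_admissible_hasFinComponent_of_isCot
    (hdef : ∀ τ' : L →+* ℂ, InfinitePlace.mk τ' ≠ InfinitePlace.mk ι → (H.map τ').PosDef) (h2 : 2 ≤ Module.finrank ℚ ↥(maximalRealSubfield L))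
    (P : DiscreteAutomorphicRep (adelicGroupData (↥(maximalRealSubfield L)) L (IsCMField.complexConj L) 3 H) μ)
    (hP : P.IsHolCotangentAt (cmArchSection L ι H T hT) (cmCompactFactor L ι H T hT) ∨
      P.IsAntiholCotangentAt (cmArchSection L ι H T hT) (cmCompactFactor L ι H T hT)) :
    ∃ (W : Type) (_ : AddCommGroup W) (_ : Module ℂ W)
      (σ : Representation ℂ (finAdelic (↥(maximalRealSubfield L)) L (IsCMField.complexConj L) 3 H) W),
      σ.IsIrreducible ∧ σ.IsAdmissible ∧ P.HasFinComponent σ :=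
  hP.elim (exists_irreducible_admissible_hasFinComponent_of_isHolCotangentAt ι T hT hdef h2 P)
    (exists_irreducible_admissible_hasFinComponent_of_isAntiholCotangentAt ι T hT hdef h2 P)

/-! ## §3 The law (L7″) `LocalIsotypyFin` at `𝔠₀` on the cotangent locus -/

/-- **(L7″) LOCAL ISOTYPY AT FINITE PLACES for `P` of cotangent type, in-house** — the T5 v6 law `localIsotypyFin` at `𝔠₀` (`clFin c v := clFinChoice (rep c) v`)
restricted to `IsCot P`: every constituent class of `P^∞|_{U(H)(L⁺_v)}` equals `clFinChoice (rep (cl P)) v` (★ `eq_clFinChoice_of_isConstituentOf` fed by §2 instead of «AFA»).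
[cite: FlathCorvallis1979, Thm. 3] [cite: BorelJacquetCorvallis1979, §4.6] [cite: Rogawski1990, §14.5 p. 237] -/
theorem localIsotypyFin₀_of_isCot
    (hdef : ∀ τ' : L →+* ℂ, InfinitePlace.mk τ' ≠ InfinitePlace.mk ι → (H.map τ').PosDef) (h2 : 2 ≤ Module.finrank ℚ ↥(maximalRealSubfield L))
    (P : DiscreteAutomorphicRep (adelicGroupData (↥(maximalRealSubfield L)) L (IsCMField.complexConj L) 3 H) μ)
    (hP : P.IsHolCotangentAt (cmArchSection L ι H T hT) (cmCompactFactor L ι H T hT) ∨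
      P.IsAntiholCotangentAt (cmArchSection L ι H T hT) (cmCompactFactor L ι H T hT))
    (v : HeightOneSpectrum (𝓞 ↥(maximalRealSubfield L))) (c' : IrrClass ((cmDatum L 3 H).Local v))
    (hc' : (IrrClass.comap (localPiEquiv L (IsCMField.complexConj L) 3 H v) c').IsConstituentOf
      (P.finRep.smoothPart.toRepresentation.comp (inclPlace (↥(maximalRealSubfield L)) L (IsCMField.complexConj L) 3 H v))) :
    c' = clFinChoice (rep (adelicGroupData (↥(maximalRealSubfield L)) L (IsCMField.complexConj L) 3 H) μ
      (cl (adelicGroupData (↥(maximalRealSubfield L)) L (IsCMField.complexConj L) 3 H) μ P)) v := by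
  obtain ⟨W, _, _, σ, hirr, hadm, hPσ⟩ := exists_irreducible_admissible_hasFinComponent_of_isCot ι T hT hdef h2 P hP
  exact eq_clFinChoice_of_isConstituentOf L H P hirr hadm hPσ v c' hc'

end Cot

end Summit.HodgeConjecture.HodgeConjecture.Cruxes.H413.F0P3AutomorphicFlathAdmissibleOfCot

end
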